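import Mathlib
import Summits.Ventures.HodgeRepro.Tier4.Common.SettingOfData
import Summits.Ventures.HodgeRepro.Tier4.Line1.RtfSpectralStep
import Summits.Ventures.HodgeRepro.Tier4.Line4.L1ClassV3
import Summits.Ventures.HodgeRepro.Tier4.Line4.ArchDistBounds
import Summits.Ventures.HodgeRepro.Tier4.Line4.OrbitDecay
import Summits.Ventures.HodgeRepro.Tier4.Line4.SuppMeasure

/-!
# Tier4/Line4/OrbitDecayLevel — C-L4-ORBDECAY-LEVEL: the orbital term of a decaying level test, bounded by the orbit's
FOLDED LEVEL MEASURE times the decay at the orbit size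

Blind re-derivation cell `pub-hodge-repro`, Tier 4 «PROVE THE STEP» (README §9–§10), LINE L4, cut C-L4-ORBDECAY-LEVEL
(lead (R-30) S15136 / (R-32) S15152; statement line S15182), seat t4-L2-p3 (gen 4).

THE SHAPE (the level-measure form of record, crit-1 Entry 129 / checklist S15142 (ii)).  OrbitDecay's (2) charged every
orbital the FULL torus measure `μ_T(D_T) μ_T′(D_T′)` times a uniform term count `Fc`; on the shrinking level family this is
the wrong unit.  Here the orbital of a function `F` with weight-3 decay that is SUPPORTED on the level double coset at the
finite places (`F x ≠ 0 → x_f ∈ K(N) γ₀,f K(N)`, the family's `suppFin`/`suppFin₂`) is bounded by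
`C₀ e^{3c} e^{−3 d(o)}` times the orbit's folded level count
`∫_{D_T} ∫_{D_T′} #{γ ∈ o : (t⁻¹ γ t′)_f ∈ K(N) γ₀,f K(N)} dμ_T′ dμ_T = Σ_{γ ∈ o} (μ_T ⊗ μ_T′)(A_N γ)`
(L2-p1's `suppSetFolded`, SuppMeasure p704106, summed over the double coset), the decay at the orbit size
`d(o) ≤ archDist γ` (`orbitDist_le`) with the torus shift `c` (`exists_archDist_le_conj_DT_add`) displayed.  Stated with
ITERATED `lintegral`s and `enorm`: no measurability of the count is needed (`enorm_integral_le_lintegral_enorm`,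
`lintegral_mono_ae`); the only binder beyond OrbitDecay's is the finiteness of the count (TORUSFIN's finiteness, no
bound).

Mathlib + the landed L1 / L4 modules only; no printed input; nothing here asserts anything about the truth of (P);
HC_CM is NOT proved by anyone in this repository.
-/

set_option autoImplicit false

noncomputable section

namespace Summit.Ventures.HodgeRepro.Tier4.Line4.L1Class

open MeasureTheory Topology Filter NumberField Summit.Ventures.HodgeRepro.Tier4.Common
  Summit.Ventures.HodgeRepro.Tier4.Line1 Summit.Ventures.HodgeRepro.Tier4.Line1.RTF
  Summit.Ventures.HodgeRepro.Tier4.Line4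
open scoped Pointwise ComplexConjugate ENNReal

variable {k : Type} [Field k] [NumberField k] (W : PlaneData k) [MeasurableSpace (GA W)] [BorelSpace (GA W)]
  (R : RTFData W) (μ : Measure (GA W)) [μ.IsHaarMeasure] [R.μT.IsHaarMeasure] [R.μT'.IsHaarMeasure]
  (DG : Set (GA W)) (fdG : IsFundamentalDomain (rationalPoints W) DG μ) (compG : IsCompact (closure DG))
  (compT : IsCompact (closure R.DT)) (compT' : IsCompact (closure R.DT'))

/-- **C-L4-ORBDECAY-LEVEL (folded per-orbit form)**: for `‖F x‖ ≤ C₀ e^{−3 archDist x}` supported on the level double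
coset at the finite places, an orbit size `d` below the orbit, the torus-shift constant `c` of `D_T`, `D_T′`, and a
finite count of level-supported terms at every `(t, t′)`:
`‖O_o(F)‖ₑ ≤ C₀ e^{3c} e^{−3 d(o)} · ∫_{D_T} ∫_{D_T′} #{γ ∈ o : (t⁻¹ γ t′)_f ∈ K(N) γ₀,f K(N)}`. -/
theorem enorm_orbital_le_orbitLevelMeasure {χ : (Setting.ofAdelicData W R μ DG fdG compG compT compT').T → ℂ}
    {χ' : (Setting.ofAdelicData W R μ DG fdG compG compT compT').T' → ℂ} (hu : ∀ a, ‖χ a‖ = 1)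
    (hu' : ∀ a, ‖χ' a‖ = 1) {F : GA W → ℂ} {C₀ : ℝ} (hC₀ : 0 ≤ C₀)
    (hF : ∀ x, ‖F x‖ ≤ C₀ * Real.exp (-(3 * archDist W x))) (γ₀ : GA W) (N : ℕ)
    (hsupp : ∀ x, F x ≠ 0 → GA.ofFinPart W x ∈ levelDoubleCoset W N (GA.ofFinPart W γ₀))
    (d : (Setting.ofAdelicData W R μ DG fdG compG compT compT').Orbit → ℝ)
    (hd : ∀ (o : (Setting.ofAdelicData W R μ DG fdG compG compT compT').Orbit)
      (γ : (Setting.ofAdelicData W R μ DG fdG compG compT compT').Gk),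
      (Setting.ofAdelicData W R μ DG fdG compG compT compT').orbitOf γ = o → d o ≤ archDist W (γ : GA W))
    {c : ℝ} (hc : ∀ (t : torusT W) (t' : torusT' W), t ∈ R.DT → t' ∈ R.DT' → ∀ g : GA W,
      archDist W g ≤ archDist W ((t : GA W)⁻¹ * g * t') + c)
    (o : (Setting.ofAdelicData W R μ DG fdG compG compT compT').Orbit)
    (hfin : ∀ (t : torusT W) (t' : torusT' W),
      {γ : {γ : (Setting.ofAdelicData W R μ DG fdG compG compT compT').Gk //
        (Setting.ofAdelicData W R μ DG fdG compG compT compT').orbitOf γ = o} |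
        GA.ofFinPart W ((t : GA W)⁻¹ * γ.1 * t') ∈ levelDoubleCoset W N (GA.ofFinPart W γ₀)}.Finite) :
    ‖(Setting.ofAdelicData W R μ DG fdG compG compT compT').orbital χ χ' o F‖ₑ ≤
      ENNReal.ofReal (C₀ * Real.exp (3 * c) * Real.exp (-(3 * d o))) *
        ∫⁻ t in R.DT, (∫⁻ t' in R.DT',
          (∑' γ : {γ : (Setting.ofAdelicData W R μ DG fdG compG compT compT').Gk //
            (Setting.ofAdelicData W R μ DG fdG compG compT compT').orbitOf γ = o},
            (suppSetFolded W R γ₀ N γ.1).indicator (fun _ => (1 : ℝ≥0∞)) (t, t')) ∂(R.μT')) ∂(R.μT) := by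
  set D : ℝ := C₀ * Real.exp (3 * c) * Real.exp (-(3 * d o)) with hD
  have hD0 : 0 ≤ D := by positivity
  -- the count at `(t, t′)`
  set cnt : torusT W → torusT' W → ℝ≥0∞ := fun t t' =>
    ∑' γ : {γ : (Setting.ofAdelicData W R μ DG fdG compG compT compT').Gk // (Setting.ofAdelicData W R μ DG fdG compG compT compT').orbitOf γ = o},
      (suppSetFolded W R γ₀ N γ.1).indicator (fun _ => (1 : ℝ≥0∞)) (t, t')
    with hcnt
  -- pointwise on `D_T × D_T′`: the partial kernel is bounded by `D · count`
  have hpt : ∀ t ∈ R.DT, ∀ t' ∈ R.DT',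
      ‖(Setting.ofAdelicData W R μ DG fdG compG compT compT').partialKernel o F t t' * χ t * conj (χ' t')‖ₑ ≤ ENNReal.ofReal D * cnt t t' := by
    intro t ht t' ht'
    have hfin' := hfin t t'
    -- each level-supported term is `≤ D`
    have hterm : ∀ γ : {γ : (Setting.ofAdelicData W R μ DG fdG compG compT compT').Gk // (Setting.ofAdelicData W R μ DG fdG compG compT compT').orbitOf γ = o},
        ‖F ((t : GA W)⁻¹ * γ.1 * t')‖ ≤ D := by
      intro γ
      have h1 := hc t t' ht ht' (γ.1 : GA W)
      have h2 : d o ≤ archDist W (γ.1 : GA W) := hd o γ.1 γ.2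
      calc ‖F ((t : GA W)⁻¹ * γ.1 * t')‖ ≤ C₀ * Real.exp (-(3 * archDist W ((t : GA W)⁻¹ * γ.1 * t'))) := hF _
        _ ≤ C₀ * (Real.exp (3 * c) * Real.exp (-(3 * d o))) := by
            refine mul_le_mul_of_nonneg_left ?_ hC₀
            rw [← Real.exp_add]
            exact Real.exp_le_exp.2 (by linarith)
        _ = D := by rw [hD]; ring
    -- the partial kernel is the finite sum over the level-supported terms
    have hker : (Setting.ofAdelicData W R μ DG fdG compG compT compT').partialKernel o F t t' = ∑ γ ∈ hfin'.toFinset, F ((t : GA W)⁻¹ * γ.1 * t') := by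
      unfold Setting.partialKernel
      apply tsum_eq_sum
      intro γ hγ
      by_contra hne
      exact hγ (hfin'.mem_toFinset.2 (hsupp _ hne))
    -- the count dominates the cardinality of the level-supported set
    have hcard : (hfin'.toFinset.card : ℝ≥0∞) ≤ cnt t t' := by
      have h1 : ∑ γ ∈ hfin'.toFinset, (suppSetFolded W R γ₀ N γ.1).indicator (fun _ => (1 : ℝ≥0∞)) (t, t') =
          hfin'.toFinset.card := by
        rw [Finset.card_eq_sum_ones, Nat.cast_sum]
        refine Finset.sum_congr rfl fun γ hγ => ?_
        rw [Set.indicator_of_mem]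
        · simp
        · exact ⟨ht, ht', hfin'.mem_toFinset.1 hγ⟩
      rw [← h1]
      exact ENNReal.sum_le_tsum _
    rw [hker, ← ofReal_norm, norm_mul, norm_mul, hu, RCLike.norm_conj, hu', mul_one, mul_one]
    calc ENNReal.ofReal ‖∑ γ ∈ hfin'.toFinset, F ((t : GA W)⁻¹ * γ.1 * t')‖
        ≤ ENNReal.ofReal (∑ γ ∈ hfin'.toFinset, ‖F ((t : GA W)⁻¹ * γ.1 * t')‖) :=
          ENNReal.ofReal_le_ofReal (norm_sum_le _ _)
      _ ≤ ENNReal.ofReal (∑ _γ ∈ hfin'.toFinset, D) :=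
          ENNReal.ofReal_le_ofReal (Finset.sum_le_sum fun γ _ => hterm γ)
      _ = ENNReal.ofReal D * hfin'.toFinset.card := by
          rw [Finset.sum_const, nsmul_eq_mul, ENNReal.ofReal_mul (Nat.cast_nonneg _), ENNReal.ofReal_natCast, mul_comm]
      _ ≤ ENNReal.ofReal D * cnt t t' := mul_le_mul_right hcard _
  -- integrate: `enorm` of the iterated Bochner integral against the iterated `lintegral`
  have hDT : NullMeasurableSet R.DT R.μT := R.DT_fund.nullMeasurableSet
  have hDT' : NullMeasurableSet R.DT' R.μT' := R.DT'_fund.nullMeasurableSet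
  have hinner : ∀ t ∈ R.DT, ‖∫ t' in R.DT', (Setting.ofAdelicData W R μ DG fdG compG compT compT').partialKernel o F t t' * χ t * conj (χ' t') ∂(R.μT')‖ₑ ≤
      ENNReal.ofReal D * ∫⁻ t' in R.DT', cnt t t' ∂(R.μT') := by
    intro t ht
    calc ‖∫ t' in R.DT', (Setting.ofAdelicData W R μ DG fdG compG compT compT').partialKernel o F t t' * χ t * conj (χ' t') ∂(R.μT')‖ₑ
        ≤ ∫⁻ t' in R.DT', ‖(Setting.ofAdelicData W R μ DG fdG compG compT compT').partialKernel o F t t' * χ t * conj (χ' t')‖ₑ ∂(R.μT') :=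
          enorm_integral_le_lintegral_enorm _
      _ ≤ ∫⁻ t' in R.DT', ENNReal.ofReal D * cnt t t' ∂(R.μT') := by
          refine lintegral_mono_ae ?_
          filter_upwards [ae_restrict_mem₀ hDT'] with t' ht'
          exact hpt t ht t' ht'
      _ = ENNReal.ofReal D * ∫⁻ t' in R.DT', cnt t t' ∂(R.μT') := lintegral_const_mul' _ _ ENNReal.ofReal_ne_top
  calc ‖(Setting.ofAdelicData W R μ DG fdG compG compT compT').orbital χ χ' o F‖ₑ
      = ‖∫ t in R.DT, (∫ t' in R.DT', (Setting.ofAdelicData W R μ DG fdG compG compT compT').partialKernel o F t t' * χ t * conj (χ' t') ∂(R.μT')) ∂(R.μT)‖ₑ := rfl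
    _ ≤ ∫⁻ t in R.DT, ‖∫ t' in R.DT', (Setting.ofAdelicData W R μ DG fdG compG compT compT').partialKernel o F t t' * χ t * conj (χ' t') ∂(R.μT')‖ₑ ∂(R.μT) :=
        enorm_integral_le_lintegral_enorm _
    _ ≤ ∫⁻ t in R.DT, (ENNReal.ofReal D * ∫⁻ t' in R.DT', cnt t t' ∂(R.μT')) ∂(R.μT) := by
        refine lintegral_mono_ae ?_
        filter_upwards [ae_restrict_mem₀ hDT] with t ht
        exact hinner t ht
    _ = ENNReal.ofReal D * ∫⁻ t in R.DT, (∫⁻ t' in R.DT', cnt t t' ∂(R.μT')) ∂(R.μT) :=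
        lintegral_const_mul' _ _ ENNReal.ofReal_ne_top

end Summit.Ventures.HodgeRepro.Tier4.Line4.L1Class

end
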